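import Literature.Computability.AlgebraicComplexity.LR17EquivariantRepresentations
import Literature.Computability.AlgebraicComplexity.GrenetWeightedPaths
import Literature.Computability.AlgebraicComplexity.GrenetPathPotentials
import HarnessLib

/-!
# LR17 Prop. 2.16 — the exterior-algebra representation of `det_m`: determinant and regularity

Topic `Literature/Computability/AlgebraicComplexity`. Companion (proofs only, no definitions, no
named facts) of `LR17EquivariantRepresentations.lean`, where Landsberg–Ressayre's Prop. 2.16
(arXiv:1508.05788, p0007:L22–L40; Differential Geom. Appl. 55 (2017) 146–166) is vended as the matrix
`LR17.detHalfMatrix k m` on `LR17.HalfIdx m = {S ⊊ [m]}` (`ℂ^{2^m-1} = ⊕_{j<m} Λ^jE`, basis `e_S`):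
`Ã = Λ₀ + Σ_k ex_k f_{k+1}` — `1` on the diagonal at levels `≥ 1`, and the Koszul-signed variable
`ε(S,i) y^{|S|+1}_i` (`y^c_i = X (i, c)`, the tree's `Grenet.wt`) in row `S ∪ {i}` (top level wrapped
to `∅`), column `S` — together with the printed sign `LR17.detHalfSign m` ("`det_m = det_n ∘ Ã` if
`m ≡ 1,2 mod 4` and `det_m = -det_n ∘ Ã` if `m ≡ 0,3 mod 4`", p0007:L35–L36) and the named fact
`lr_prop_2_16` (regular AND `GL(E)`-equivariant).

## What is proved here (the FIRST conjunct of `lr_prop_2_16`, for every field, every `m ≥ 1` and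
## every indexing `e : HalfIdx m ≃ Fin n`)
* `LR17.det_detHalfMatrix` — **`det Ã = detHalfSign m · det_m`** over any commutative ring (this
  confirms the printed mod-4 sign for all `m`; the statements file checked it numerically for
  `m ≤ 6`).  Proof, following the paper's "signed Grenet branching program" reading of `Ã`
  (p0007:L41–L70: the `m = 2, 3` instances) with the tree's path calculus for arc-weighted subset
  lattices (`GrenetWeightedPaths.lean`): `Ãᵀ` is the `(≠ univ)`-block of the unipotent matrix
  `1 - A` — `A` the adjacency matrix of the subset lattice of `Fin m` with the signed arc weights
  `w S j = -ε(S,j) y^{|S|+1}_j` — after its row `univ` is replaced by the unit vector at `∅` and its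
  columns `∅`, `univ` are swapped (the wrap `Λ^mE ≃ Λ^0E`); the swapped matrix is block triangular
  with corner entry `1`, so `det Ã = -adj(1 - A)_{∅, univ}` (`Matrix.adjugate_apply`,
  `Matrix.det_permute'`, `Matrix.twoBlockTriangular_det`), which is minus the full signed path sum
  `Σ_σ ∏_t w(σ({i<t}), σ t)` (`Grenet.arc_adjugate_one_sub_empty_univ`); and along the maximal chain
  of an ordering `σ` the Koszul signs multiply to `(-1)^{m(m-1)/2} sign σ`
  (`LR17.prod_koszulSign_prefix`, via the inversion count `Equiv.Perm.signAux`), whence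
  `det Ã = -(-1)^m (-1)^{m(m-1)/2} det_m = detHalfSign m · det_m` (`LR17.detHalfSign_eq_neg_prod`).
* `LR17.totalDegree_detHalfMatrix_le`, `LR17.constPart_detHalfMatrix` (`Ã(0) = Λ₀ = diag(0,1,…,1)`,
  zero exactly at the merged vertex `∅`), `LR17.rank_constPart_reindex_detHalfMatrix`
  (`rank Λ₀ = n - 1`), and **`LR17.isRegularDetRepr_detHalfMatrix`**:
  `IsRegularDetRepr (C (detHalfSign m) * detPoly (Fin m) k) (reindex e e (detHalfMatrix k m))`.
The second conjunct of `lr_prop_2_16` (exact `GL(E)`-lifts `⊕_j ∧^j g`, p0012:L40–L63) is NOT proved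
here; with it, `lr_prop_2_16` and hence `srdc_{GL(E)}(det_m) = 2^m - 1` (`lr_thm_2_14_eq`) follow.
Honest framing (cell `val-lit`): a discharge of printed content; nothing here bears on `VP ≠ VNP`
beyond what Landsberg–Ressayre print.

## References
* [LandsbergRessayre2017] J. M. Landsberg, N. Ressayre, *Permanent v. determinant: an exponential
  lower bound assuming symmetry and a potential path towards Valiant's conjecture*, Differential
  Geom. Appl. 55 (2017) 146–166, arXiv:1508.05788, Prop. 2.16 (p0007:L22–L70), §4.1 (p0012:L38–L88).
* [Grenet2012Thesis] B. Grenet, PhD thesis, ENS Lyon (2012), Lemme 3.17 (path sums of the subset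
  lattice; the tree's `GrenetWeightedPaths.lean`).
-/

noncomputable section

open Matrix MvPolynomial Finset

namespace Literature.Computability.AlgebraicComplexity

namespace LR17

section Sign

variable {m : ℕ}

/-- `signAux = sign` on `Perm (Fin m)`. [folklore] -/
private theorem signAux_eq_sign (σ : Equiv.Perm (Fin m)) :
    Equiv.Perm.signAux σ = Equiv.Perm.sign σ := by
  induction σ using Equiv.Perm.swap_induction_on with
  | one => rw [Equiv.Perm.signAux_one, Equiv.Perm.sign_one]
  | swap_mul f x y hxy ih =>
    rw [Equiv.Perm.signAux_mul, Equiv.Perm.sign_mul, ih, Equiv.Perm.signAux_swap hxy,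
      Equiv.Perm.sign_swap hxy]

/-- The sign of a permutation of `Fin m` as the product over the pairs of positions `u < t` of
`-1` for an inversion and `1` otherwise. [folklore] -/
private theorem sign_eq_prod_prod (σ : Equiv.Perm (Fin m)) :
    ((Equiv.Perm.sign σ : ℤˣ) : ℤ) =
      ∏ t : Fin m, ∏ u : Fin m, if u < t then (if σ t ≤ σ u then -1 else 1) else 1 := by
  rw [← signAux_eq_sign, Equiv.Perm.signAux]
  have hset : Equiv.Perm.finPairsLT m =
      univ.filter fun x : (Σ _ : Fin m, Fin m) => x.2 < x.1 := by
    ext x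
    simp [Equiv.Perm.mem_finPairsLT]
  have hsig : ∀ g : (Σ _ : Fin m, Fin m) → ℤ, ∏ x, g x = ∏ t, ∏ u, g ⟨t, u⟩ := fun g => by
    rw [← Finset.univ_sigma_univ, Finset.prod_sigma]
  rw [hset, Finset.prod_filter, Units.coe_prod, hsig]
  refine Finset.prod_congr rfl fun t _ => Finset.prod_congr rfl fun u _ => ?_
  split_ifs <;> simp

/-- The Koszul sign of the `t`-th step of the maximal chain `∅ ⊂ {σ 0} ⊂ {σ 0, σ 1} ⊂ ⋯` as a
product over the earlier positions. [folklore] -/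
private theorem koszulSign_prefix (σ : Equiv.Perm (Fin m)) (t : Fin m) :
    koszulSign ((univ.filter fun i : Fin m => (i : ℕ) < (t : ℕ)).image σ) (σ t) =
      ∏ u : Fin m, if u < t then (if σ u < σ t then -1 else 1) else 1 := by
  unfold koszulSign
  rw [Finset.filter_image, card_image_of_injective _ σ.injective, Finset.filter_filter,
    ← Finset.prod_const (-1 : ℤ), Finset.prod_filter]
  refine Finset.prod_congr rfl fun u _ => ?_
  rw [ite_and]
  exact if_congr Fin.lt_def.symm rfl rfl

/-- **The Koszul signs along a maximal chain multiply to the sign of the ordering**, up to the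
fixed sign `∏_t (-1)^t = (-1)^{m(m-1)/2}`:
`∏_t ε(σ({i<t}), σ t) = (-1)^{m(m-1)/2} sign σ` (the general-ordering form of "specialize to the
diagonal matrices … `yⁱᵢ` appears in the large matrix with the sign `(-1)^{i+1}`", p0012:L71–L73).
[cite: LandsbergRessayre2017, Prop. 2.16 (proof, p0012:L71–L73)] -/
theorem prod_koszulSign_prefix (σ : Equiv.Perm (Fin m)) :
    (∏ t : Fin m, koszulSign ((univ.filter fun i : Fin m => (i : ℕ) < (t : ℕ)).image σ) (σ t)) =
      (∏ t : Fin m, (-1 : ℤ) ^ (t : ℕ)) * (Equiv.Perm.sign σ : ℤ) := by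
  have hsq : ((Equiv.Perm.sign σ : ℤˣ) : ℤ) * ((Equiv.Perm.sign σ : ℤˣ) : ℤ) = 1 := by
    rw [← Units.val_mul, Int.units_mul_self, Units.val_one]
  have key : (∏ t : Fin m, koszulSign ((univ.filter fun i : Fin m => (i : ℕ) < (t : ℕ)).image σ)
      (σ t)) * ((Equiv.Perm.sign σ : ℤˣ) : ℤ) = ∏ t : Fin m, (-1 : ℤ) ^ (t : ℕ) := by
    simp_rw [koszulSign_prefix, sign_eq_prod_prod, ← Finset.prod_mul_distrib]
    refine Finset.prod_congr rfl fun t _ => ?_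
    have hu : ∀ u : Fin m, ((if u < t then (if σ u < σ t then (-1 : ℤ) else 1) else 1) *
        (if u < t then (if σ t ≤ σ u then -1 else 1) else 1)) = if u < t then -1 else 1 := by
      intro u
      by_cases hut : u < t
      · by_cases h1 : σ u < σ t
        · simp [hut, h1, not_le.mpr h1]
        · simp [hut, h1, not_lt.mp h1]
      · simp [hut]
    simp_rw [hu]
    rw [← Finset.prod_filter, Finset.prod_const]
    congr 1
    have hI : (univ.filter fun u : Fin m => u < t) = Finset.Iio t := by
      ext u
      simp
    rw [hI, Fin.card_Iio]
  calc (∏ t : Fin m, koszulSign ((univ.filter fun i : Fin m => (i : ℕ) < (t : ℕ)).image σ) (σ t))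
      = (∏ t : Fin m, koszulSign ((univ.filter fun i : Fin m => (i : ℕ) < (t : ℕ)).image σ) (σ t)) *
          (((Equiv.Perm.sign σ : ℤˣ) : ℤ) * ((Equiv.Perm.sign σ : ℤˣ) : ℤ)) := by
        rw [hsq, mul_one]
    _ = (∏ t : Fin m, (-1 : ℤ) ^ (t : ℕ)) * (Equiv.Perm.sign σ : ℤ) := by
        rw [← mul_assoc, key]

/-- The printed sign of Prop. 2.16 satisfies `s(m+1) = (-1)^{m+1} s(m)`. [folklore] -/
private theorem detHalfSign_succ (m : ℕ) :
    detHalfSign (m + 1) = (-1) ^ (m + 1) * detHalfSign m := by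
  unfold detHalfSign
  have h4 : m % 4 = 0 ∨ m % 4 = 1 ∨ m % 4 = 2 ∨ m % 4 = 3 := by omega
  rcases h4 with h | h | h | h
  · have h1 : (m + 1) % 4 = 1 := by omega
    have hp : Odd (m + 1) := Nat.odd_iff.mpr (by omega)
    simp [h, h1, hp.neg_one_pow]
  · have h1 : (m + 1) % 4 = 2 := by omega
    have hp : Even (m + 1) := Nat.even_iff.mpr (by omega)
    simp [h, h1, hp.neg_one_pow]
  · have h1 : (m + 1) % 4 = 3 := by omega
    have hp : Odd (m + 1) := Nat.odd_iff.mpr (by omega)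
    simp [h, h1, hp.neg_one_pow]
  · have h1 : (m + 1) % 4 = 0 := by omega
    have hp : Even (m + 1) := Nat.even_iff.mpr (by omega)
    simp [h, h1, hp.neg_one_pow]

/-- Closed form of the printed sign: `s(m) = -(-1)^m ∏_{t<m} (-1)^t` (`= -(-1)^{m(m+1)/2}`,
i.e. `+1` iff `m ≡ 1, 2 mod 4`: "Thus the total sign is `-1` if `m ≡ 0, 3 mod 4` and `+1` if
`m ≡ 1, 2 mod 4`", p0012:L87). [cite: LandsbergRessayre2017, Prop. 2.16 (proof, p0012:L71–L87)] -/
theorem detHalfSign_eq_neg_prod (m : ℕ) :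
    (detHalfSign m : ℤ) = -((-1) ^ m * ∏ t : Fin m, (-1 : ℤ) ^ (t : ℕ)) := by
  induction m with
  | zero => simp [detHalfSign]
  | succ m ih =>
    rw [detHalfSign_succ, ih, Fin.prod_univ_castSucc]
    simp only [Fin.val_castSucc, Fin.val_last]
    ring

end Sign

/-! ### The determinant of Prop. 2.16's matrix -/

section Det

variable (k : Type*) [CommRing k] (m : ℕ)

/-- The generic determinant as a signed permutation sum with `C`-coefficients. [folklore] -/
private theorem detPoly_fin_eq_sum :
    detPoly (Fin m) k =
      ∑ σ : Equiv.Perm (Fin m), C ((Equiv.Perm.sign σ : ℤ) : k) * ∏ i, X (σ i, i) := by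
  rw [detPoly, Matrix.det_apply]
  refine Finset.sum_congr rfl fun σ _ => ?_
  rw [Units.smul_def, ← Int.cast_smul_eq_zsmul k, MvPolynomial.smul_eq_C_mul]
  rfl

variable {m} in
/-- The wrap `[m] ↦ ∅` versus the transposition `(∅ univ)` of the subset lattice: for `T ≠ univ`
and `Z ≠ ∅`, `swap ∅ univ T = Z ↔ T = wrap Z`. [folklore] -/
private theorem swap_eq_iff_eq_wrap {T Z : Finset (Fin m)} (hT : T ≠ univ) (hZ : Z ≠ ∅) :
    Equiv.swap ∅ univ T = Z ↔ T = wrap m Z := by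
  unfold wrap
  split_ifs with hZu
  · subst hZu
    rw [Equiv.swap_apply_eq_iff, Equiv.swap_apply_right]
  · constructor
    · intro h
      have hT0 : T ≠ ∅ := by
        rintro rfl
        rw [Equiv.swap_apply_left] at h
        exact hZu h.symm
      rwa [Equiv.swap_apply_of_ne_of_ne hT0 hT] at h
    · rintro rfl
      exact Equiv.swap_apply_of_ne_of_ne hZ hZu

/-- **`det Ã = s(m) · det_m` for Prop. 2.16's matrix** (LR17 p0007:L35–L36: "`det_m = det_n∘Ã` if
`m ≡ 1,2 mod 4` and `det_m = -det_n∘Ã` if `m ≡ 0,3 mod 4`"), over any commutative ring, `m ≥ 1`.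
Proof: the transpose of `Ã` is the `(≠ univ)`-block of the unipotent `1 - A` (`A` the subset-lattice
adjacency matrix with the signed arc weights `-ε(S,j) y^{|S|+1}_j`) after replacing the row of `univ`
by the unit vector at `∅` and swapping the columns `∅`, `univ`; so `det Ã = -adj(1 - A)_{∅,univ}`, the
full signed path sum (`Grenet.arc_adjugate_one_sub_empty_univ`), and the Koszul signs along each
maximal chain multiply to `(-1)^{m(m-1)/2} sign σ` (`prod_koszulSign_prefix`).
[cite: LandsbergRessayre2017, Prop. 2.16] -/
theorem det_detHalfMatrix (hm : 1 ≤ m) :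
    (detHalfMatrix k m).det = C ((detHalfSign m : ℤ) : k) * detPoly (Fin m) k := by
  classical
  have hne : (∅ : Finset (Fin m)) ≠ univ := by
    haveI : Nonempty (Fin m) := ⟨⟨0, hm⟩⟩
    exact Finset.univ_nonempty.ne_empty.symm
  -- the signed arc weights and the adjacency matrix of the subset lattice
  set w : Finset (Fin m) → Fin m → MvPolynomial (Fin m × Fin m) k :=
    fun S j => -(C ((koszulSign S j : ℤ) : k) * Grenet.wt k m j S.card) with hw
  set A : Matrix (Finset (Fin m)) (Finset (Fin m)) (MvPolynomial (Fin m × Fin m) k) :=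
    Matrix.of fun S T => ∑ j, if j ∉ S ∧ T = insert j S then w S j else 0 with hAdef
  have hA : ∀ S T, A S T = ∑ j, if j ∉ S ∧ T = insert j S then w S j else 0 := fun _ _ => rfl
  set D : Matrix (Finset (Fin m)) (Finset (Fin m)) (MvPolynomial (Fin m × Fin m) k) :=
    (1 - A).updateRow univ (Pi.single ∅ 1) with hD
  set D' : Matrix (Finset (Fin m)) (Finset (Fin m)) (MvPolynomial (Fin m × Fin m) k) :=
    D.submatrix id (Equiv.swap ∅ univ) with hD'
  -- `Ãᵀ` is the `(≠ univ)`-block of `D'`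
  have hblock : (detHalfMatrix k m)ᵀ = D'.toSquareBlockProp fun S => S ≠ univ := by
    refine Matrix.ext fun S T => ?_
    rw [Matrix.transpose_apply, Matrix.toSquareBlockProp_def, Matrix.of_apply, hD',
      Matrix.submatrix_apply, id, hD, Matrix.updateRow_ne S.2, Matrix.sub_apply, Matrix.one_apply,
      hA, detHalfMatrix, Matrix.of_apply, sub_eq_add_neg, ← Finset.sum_neg_distrib]
    congr 1
    · by_cases hS0 : S.1 = ∅
      · have h1 : ¬(T = S ∧ S.1.Nonempty) := fun h => by
          rw [hS0] at h
          exact Finset.not_nonempty_empty h.2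
        have h2 : ¬(S.1 = Equiv.swap ∅ univ T.1) := by
          rw [hS0, eq_comm, Equiv.swap_apply_eq_iff, Equiv.swap_apply_left]
          exact T.2
        rw [if_neg h1, if_neg h2]
      · have key : (T = S ∧ S.1.Nonempty) ↔ S.1 = Equiv.swap ∅ univ T.1 := by
          rw [eq_comm (a := S.1), swap_eq_iff_eq_wrap T.2 hS0, wrap, if_neg S.2]
          constructor
          · rintro ⟨rfl, -⟩
            rfl
          · intro h
            exact ⟨Subtype.ext h, Finset.nonempty_iff_ne_empty.mpr hS0⟩
        simp only [key]
    · refine Finset.sum_congr rfl fun i _ => ?_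
      by_cases hi : i ∈ S.1
      · simp [hi]
      · have key : T.1 = wrap m (insert i S.1) ↔ Equiv.swap ∅ univ T.1 = insert i S.1 :=
          (swap_eq_iff_eq_wrap T.2 (Finset.insert_ne_empty i S.1)).symm
        simp only [hi, not_false_eq_true, true_and, key, hw]
        split_ifs <;> simp
  -- `D'` is block lower triangular with corner entry `1`
  have htri : ∀ S, ¬(S ≠ univ) → ∀ T, T ≠ univ → D' S T = 0 := by
    intro S hS T hT
    rw [not_ne_iff] at hS
    subst hS
    have hsw : Equiv.swap ∅ univ T ≠ ∅ := by
      intro h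
      rw [Equiv.swap_apply_eq_iff, Equiv.swap_apply_left] at h
      exact hT h
    rw [hD', Matrix.submatrix_apply, id, hD, Matrix.updateRow_self]
    exact Pi.single_eq_of_ne hsw _
  have hcorner : (D'.toSquareBlockProp fun S => ¬(S ≠ univ)).det = 1 := by
    have hcard : Fintype.card {S : Finset (Fin m) // ¬(S ≠ univ)} = 1 := by
      rw [Fintype.card_subtype]
      simp [Finset.filter_eq', Finset.mem_univ]
    rw [Matrix.det_eq_elem_of_card_eq_one hcard ⟨univ, fun h => h rfl⟩,
      Matrix.toSquareBlockProp_def, Matrix.of_apply, hD', Matrix.submatrix_apply, id, hD,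
      Matrix.updateRow_self, Equiv.swap_apply_right, Pi.single_eq_same]
  have hdetD' : D'.det = (detHalfMatrix k m).det := by
    rw [Matrix.twoBlockTriangular_det D' (fun S => S ≠ univ) htri, hcorner, mul_one, ← hblock,
      Matrix.det_transpose]
  -- `det Ã = det D' = -det D = -adj(1 - A)_{∅, univ} = -(full signed path sum)`
  have hdet : (detHalfMatrix k m).det =
      -∑ σ : Equiv.Perm (Fin m),
        ∏ t : Fin m, w ((univ.filter fun i : Fin m => (i : ℕ) < (t : ℕ)).image σ) (σ t) := by
    rw [← hdetD', hD', Matrix.det_permute', Equiv.Perm.sign_swap hne, hD, ← Matrix.adjugate_apply,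
      Grenet.arc_adjugate_one_sub_empty_univ w hA, Grenet.sum_ite_injective]
    simp
  -- the path products
  have hpath : ∀ σ : Equiv.Perm (Fin m),
      (∏ t : Fin m, w ((univ.filter fun i : Fin m => (i : ℕ) < (t : ℕ)).image σ) (σ t)) =
        (-1) ^ m * (C ((((∏ t : Fin m, (-1 : ℤ) ^ (t : ℕ)) * (Equiv.Perm.sign σ : ℤ) : ℤ)) : k) *
          ∏ t : Fin m, X (σ t, t)) := by
    intro σ
    have hwt : ∀ t : Fin m, w ((univ.filter fun i : Fin m => (i : ℕ) < (t : ℕ)).image σ) (σ t) =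
        (-1) * (C ((koszulSign ((univ.filter fun i : Fin m => (i : ℕ) < (t : ℕ)).image σ) (σ t) : ℤ) : k)
          * X (σ t, t)) := by
      intro t
      have hc : ((univ.filter fun i : Fin m => (i : ℕ) < (t : ℕ)).image σ).card = t :=
        Grenet.card_prefix_image σ (le_of_lt t.2)
      simp only [hw, hc]
      unfold Grenet.wt
      rw [dif_pos t.2, Fin.eta, neg_one_mul]
    simp_rw [hwt]
    rw [Finset.prod_mul_distrib, Finset.prod_const, Finset.card_univ, Fintype.card_fin,
      Finset.prod_mul_distrib, ← map_prod C, ← Int.cast_prod, prod_koszulSign_prefix]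
  rw [hdet]
  simp_rw [hpath]
  rw [detPoly_fin_eq_sum, detHalfSign_eq_neg_prod, Finset.mul_sum, ← Finset.sum_neg_distrib]
  refine Finset.sum_congr rfl fun σ _ => ?_
  simp only [Int.cast_mul, Int.cast_prod, Int.cast_pow, Int.cast_neg, Int.cast_one, map_mul,
    map_neg, map_pow, map_prod, map_one]
  ring

end Det

/-! ### Regularity: affine entries and `rank Ã(0) = n - 1` -/

section Regular

variable (k : Type*) [Field k] (m : ℕ)

/-- The entries of Prop. 2.16's matrix are affine linear. [cite: LandsbergRessayre2017, Prop. 2.16] -/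
theorem totalDegree_detHalfMatrix_le (T S : HalfIdx m) :
    (detHalfMatrix k m T S).totalDegree ≤ 1 := by
  rw [detHalfMatrix, Matrix.of_apply]
  refine (totalDegree_add _ _).trans (max_le ?_ ?_)
  · split_ifs <;> simp
  · refine totalDegree_finsetSum_le fun i _ => ?_
    split_ifs
    · refine (totalDegree_mul _ _).trans ?_
      rw [totalDegree_C, zero_add]
      unfold Grenet.wt
      split_ifs
      · exact (totalDegree_X _).le
      · simp
    · simp

/-- The constant part of Prop. 2.16's matrix is `Λ₀ = diag(0, 1, …, 1)` (zero exactly at the merged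
vertex `∅`). [cite: LandsbergRessayre2017, Prop. 2.16] -/
theorem constPart_detHalfMatrix :
    constPart (detHalfMatrix k m) =
      Matrix.diagonal fun S : HalfIdx m => if S.1.Nonempty then (1 : k) else 0 := by
  classical
  refine Matrix.ext fun T S => ?_
  rw [constPart_apply, detHalfMatrix, Matrix.of_apply, map_add, map_sum, Matrix.diagonal_apply]
  have hwt : ∀ (j : Fin m) (c : ℕ), constantCoeff (Grenet.wt k m j c) = 0 := by
    intro j c
    unfold Grenet.wt
    split_ifs
    · exact constantCoeff_X k _
    · exact constantCoeff.map_zero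
  have hsum : (∑ i : Fin m, constantCoeff (if i ∉ S.1 ∧ T.1 = wrap m (insert i S.1)
      then C (koszulSign S.1 i : k) * Grenet.wt k m i S.1.card else 0)) = 0 := by
    refine Finset.sum_eq_zero fun i _ => ?_
    split_ifs
    · rw [map_mul, hwt, mul_zero]
    · exact constantCoeff.map_zero
  rw [hsum, add_zero]
  by_cases hTS : T = S
  · subst hTS
    simp
  · rw [if_neg hTS, if_neg fun h => hTS h.1, constantCoeff.map_zero]

variable {m} in
/-- `rank Λ₀ = n - 1` for `Λ₀ = diag(0, 1, …, 1)` on `HalfIdx m` (`m ≥ 1`) transported along `e`.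
[cite: LandsbergRessayre2017, Prop. 2.16] -/
theorem rank_constPart_reindex_detHalfMatrix (hm : 1 ≤ m) {n : ℕ} (e : HalfIdx m ≃ Fin n) :
    (constPart (Matrix.reindex e e (detHalfMatrix k m))).rank = n - 1 := by
  classical
  have hne : (∅ : Finset (Fin m)) ≠ univ := by
    haveI : Nonempty (Fin m) := ⟨⟨0, hm⟩⟩
    exact Finset.univ_nonempty.ne_empty.symm
  have hc : constPart (Matrix.reindex e e (detHalfMatrix k m)) =
      Matrix.reindex e e
        (Matrix.diagonal fun S : HalfIdx m => if S.1.Nonempty then (1 : k) else 0) := by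
    rw [← constPart_detHalfMatrix]
    rfl
  rw [hc, Matrix.rank_reindex, Matrix.rank_diagonal, Fintype.card_subtype]
  have hfilter : (univ.filter fun S : HalfIdx m => (if S.1.Nonempty then (1 : k) else 0) ≠ 0) =
      univ.erase ⟨∅, hne⟩ := by
    ext S
    simp only [Finset.mem_filter, Finset.mem_univ, true_and, Finset.mem_erase, and_true, ne_eq,
      ite_eq_right_iff, one_ne_zero, imp_false, not_not, Finset.nonempty_iff_ne_empty]
    exact not_congr (@Subtype.ext_iff _ _ S ⟨∅, hne⟩).symm
  rw [hfilter, Finset.card_erase_of_mem (Finset.mem_univ _), Finset.card_univ, Fintype.card_congr e,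
    Fintype.card_fin]

variable {m} in
/-- **Prop. 2.16, first half: `Ã` is a REGULAR determinantal representation of `s(m) · det_m`**
(size `2^m - 1`, transported to `Fin n` along any bijection `e`): affine entries,
`det Ã = s(m) det_m`, and `rank Ã(0) = rank Λ₀ = n - 1`. This is the first conjunct of the named
fact `lr_prop_2_16` (the second, `GL(E)`-equivariance, is not proved here).
[cite: LandsbergRessayre2017, Prop. 2.16] -/
theorem isRegularDetRepr_detHalfMatrix (hm : 1 ≤ m) {n : ℕ} (e : HalfIdx m ≃ Fin n) :
    IsRegularDetRepr (C ((detHalfSign m : ℤ) : k) * detPoly (Fin m) k)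
      (Matrix.reindex e e (detHalfMatrix k m)) := by
  refine ⟨⟨fun i j => ?_, ?_⟩, rank_constPart_reindex_detHalfMatrix k hm e⟩
  · rw [Matrix.reindex_apply, Matrix.submatrix_apply]
    exact totalDegree_detHalfMatrix_le k m _ _
  · rw [Matrix.det_reindex_self, det_detHalfMatrix k m hm]

end Regular

end LR17

end Literature.Computability.AlgebraicComplexity
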